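import Summits.HodgeConjecture.HodgeConjecture.Theses.DworkReflectionQuotients
import Literature.AlgebraicGeometry.HodgeTheory.DworkSexticEigenspaces
import Literature.AlgebraicGeometry.HodgeTheory.ComplexConjugationHolds
import Literature.AlgebraicGeometry.HodgeTheory.LefschetzOneOneHolds
import Literature.AlgebraicGeometry.HodgeTheory.HardLefschetzNFoldHolds

/-!
# Support item `DworkOtherCodimensions` of route `DworkReflectionQuotients` (stmt-HodgeConjecture-20244)

Route `route-HodgeConjecture-DworkReflectionQuotients` (cell `hodge-nonav`, rung F-H1 — never summit
credit). UNCONDITIONAL proof of the support item `DworkOtherCodimensions`: for `ψ⁶ ≠ 1` the Dwork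
sextic fourfold `X_ψ` has a Hodge model (`nonempty_hodgeModel_holds`, `X_ψ` being smooth projective by
Katz's Lemma 2.1, the tree theorem `DworkSextic.isSmoothProjective_fibre`) and every rational
`(p,p)`-class with `p ≠ 2` is algebraic: `p = 0` (`hodgeConjectureFor_codim_zero`), `p = 1` Lefschetz
`(1,1)` (`lefschetzOneOne_rational_holds`), `p ≥ 3` hard Lefschetz from codimension `4 − p ≤ 1`
(`HardLefschetzNFold.mem_algebraicClasses_of_lt_holds`). Tree theorems only; no named fact, no sorry.
(A candidate with the same content was attached by the planner, evidence `Cand.lean`, p2 g8.) Prover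
seat `hodge-nonav-20241-p1` (g0), 2026-08-27.

## References

* C. Voisin, *Hodge Theory and Complex Algebraic Geometry I* (2002), Thm. 11.30 (Lefschetz `(1,1)`),
  Thm. 6.25 (hard Lefschetz). [VoisinHodgeI2002]
* N. M. Katz, *Another look at the Dwork family*, Progr. Math. 270 (2009), Lemma 2.1. [Katz2009]
-/

namespace Summit.HodgeConjecture.HodgeConjecture.Theorems

open Literature.AlgebraicGeometry.HodgeTheory Literature.AlgebraicGeometry.Motives

/-- **Item stmt-HodgeConjecture-20244 (`DworkOtherCodimensions`), proved.** For `ψ⁶ ≠ 1`, `X_ψ` has a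
Hodge model and every rational `(p,p)`-class of `H^{2p}(X_ψ(ℂ); ℂ)` with `p ≠ 2` lies in
`algebraicClasses X_ψ p` (`p = 0`: everything; `p = 1`: Lefschetz `(1,1)`; `p ≥ 3`: hard Lefschetz
reduces to codimension `4 − p ∈ {0, 1}`). [cite: VoisinHodgeI2002, Thm. 11.30 and Thm. 6.25] -/
theorem dworkOtherCodimensions_proof :
    Summit.HodgeConjecture.HodgeConjecture.Theses.DworkReflectionQuotients.DworkOtherCodimensions := by
  intro ψ hψ
  dsimp only
  have hX : IsSmoothProjective 4 (DworkSextic.fibre ψ) := DworkSextic.isSmoothProjective_fibre hψ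
  refine ⟨nonempty_hodgeModel_holds (n := 4) (X := DworkSextic.fibre ψ) hX, fun p hp c hc hh => ?_⟩
  -- codimension `0`, in any spelling `q = 0` of the index
  have h0 : ∀ q : ℕ, q = 0 → ∀ c' : complexBetti (DworkSextic.fibre ψ) (2 * q),
      c' ∈ algebraicClasses (DworkSextic.fibre ψ) q := by
    rintro q rfl c'
    exact hodgeConjectureFor_codim_zero c'
  by_cases hp0 : p = 0
  · exact h0 p hp0 c
  by_cases hp1 : p = 1
  · subst hp1
    exact lefschetzOneOne_rational_holds hX c hc hh
  -- `p ≥ 3`: hard Lefschetz from codimension `4 - p ≤ 1`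
  refine HardLefschetzNFold.mem_algebraicClasses_of_lt_holds hX (by omega) (fun c' hc' hh' => ?_) c hc hh
  by_cases hp3 : p = 3
  · subst hp3
    exact lefschetzOneOne_rational_holds hX c' hc' hh'
  · exact h0 (4 - p) (by omega) c'

end Summit.HodgeConjecture.HodgeConjecture.Theorems
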